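import Summits.Ventures.DiscreteObjects.UnitDistance.TwoAdicFramesRamified
import Summits.Ventures.DiscreteObjects.UnitDistance.Sqrt2Sqrt3Plane
import Summits.Ventures.DiscreteObjects.UnitDistance.FieldPlanes

/-!
# The four step frames of `ℚ₂(i, √2, √3)` exist, and real multiquadratic fields embed into them
(cell `pub-namedobj`, target (U), seat udg g11)

Framing (verbatim for the cell): lottery ticket; floor = certified bounds/negative ranges.

Global side of U2-COMPLETE.  (1) `FullLocalData`: g10's `LocalData23` (`I, s2, s3, σ, τ, ρ` in a field `Ω ⊇ ℚ₂`) with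
the ninth action `ρ s3 = s3` recorded; it exists in `Ω₂ = \overline{ℚ₂}` (`ρ` = negate `s2` over `ℚ₂(i, s3)`, from
`2, −2, 2/3, −2/3 ∉ (ℚ₂)²`).  (2) The four frames (`TwoAdicFrames`) `frame c₁ c₂`, `(c₁, c₂) ∈ {2, −2} × {3, −3}`:
`g₁ ∈ {s2, s2·I}`, `g₂ ∈ {s3, s3·I}`, `α ∈ {σ, στ, σρ, σρτ}` — one for each maximal `[−1]`-free subgroup
`⟨[c₁],[c₂]⟩` of `ℚ₂^×/ℚ₂^{×2}`.  (3) Hensel for integers `m ≡ 1 (mod 8)`, square roots `√d ∈ ℚ₂(g₁, g₂)` whenever the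
class of `d` lies in `⟨[c₁],[c₂]⟩` (`exists_sq_eq_in_frame`), four-coefficient extraction in `ℚ₂(g₁, g₂)` (the image
lemma for `multiSqrtEmbed` is in `FieldPlanes`).  (4) THE REDUCTION THEOREMS: a subfield `K ⊆ ℝ` with a ring map into `ℚ₂(g₁, g₂)` has all its
unit-distance graphs `4`-colourable (`colorable_four_of_embedding_frame`), and `2`-colourable = BIPARTITE when `c₂ = −3`
(`colorable_two_of_embedding_frame`).  Nothing here is literature.
-/

noncomputable section

namespace Summit.Ventures.DiscreteObjects.UnitDistance.MoserLocal

open Spectral SimpleGraph Polynomial IntermediateField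
open scoped IntermediateField

/-! ## Full local data -/

/-- `LocalData23` together with the ninth action `ρ s3 = s3` (so `σ, τ, ρ` are the three coordinate sign changes of
`ℚ₂(i, √2, √3)` and every sign pattern is a word in them). -/
structure FullLocalData (Ω : Type*) [Field Ω] [Algebra ℚ_[2] Ω] extends LocalData23 Ω where
  /-- `ρ s3 = s3` -/
  ρs3 : ρ s3 = s3

section Frames

variable {Ω : Type*} [Field Ω] [Algebra ℚ_[2] Ω] (D : FullLocalData Ω)

/-- `s2 ∈ V₈`. -/
theorem FullLocalData.inV8_s2 : D.InV8 D.s2 := by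
  have := D.inV8_pair 0 1
  rwa [map_zero, map_one, zero_add, one_mul] at this

/-- `s2·I ∈ V₈`. -/
theorem FullLocalData.inV8_s2I : D.InV8 (D.s2 * D.I) := D.inV8_s2.mul D.inV8_I

/-- FRAME `(2, 3)`: `g₁ = s2`, `g₂ = s3`, `α = σ` (the field `ℚ₂(√2, √3)`; U4 / `MultiquadraticTwoThree`). -/
def FullLocalData.frame23 : D.toLocalData23.Frame where
  g₁ := D.s2
  g₂ := D.s3
  c₂ := 3
  α := D.σ
  g₁_inV8 := D.inV8_s2
  g₂_sq := by rw [D.hs3, map_ofNat]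
  αI := D.σI
  αg₁ := D.σs2
  αg₂ := D.σs3
  τg₁ := D.τs2
  τg₂ := D.τs3

/-- FRAME `(2, −3)`: `g₁ = s2`, `g₂ = s3·I`, `α = στ` (the field `ℚ₂(√2, √−3) = ℚ₂(√2, √5)`; RAMIFIED). -/
def FullLocalData.frame2m3 : D.toLocalData23.Frame where
  g₁ := D.s2
  g₂ := D.s3 * D.I
  c₂ := -3
  α := D.τ.trans D.σ
  g₁_inV8 := D.inV8_s2
  g₂_sq := by rw [mul_pow, D.hs3, D.hI, map_neg, map_ofNat]; ring
  αI := by rw [AlgEquiv.trans_apply, D.τI, D.σI]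
  αg₁ := by rw [AlgEquiv.trans_apply, D.τs2, D.σs2]
  αg₂ := by simp only [AlgEquiv.trans_apply, map_mul, map_neg, D.τs3, D.τI, D.σs3, D.σI]; ring
  τg₁ := D.τs2
  τg₂ := by rw [map_mul, D.τs3, D.τI]; ring

/-- FRAME `(−2, 3)`: `g₁ = s2·I`, `g₂ = s3`, `α = σρ` (the field `ℚ₂(√−2, √3) = ℚ₂(√14, √3)`). -/
def FullLocalData.framem23 : D.toLocalData23.Frame where
  g₁ := D.s2 * D.I
  g₂ := D.s3
  c₂ := 3
  α := D.ρ.trans D.σ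
  g₁_inV8 := D.inV8_s2I
  g₂_sq := by rw [D.hs3, map_ofNat]
  αI := by rw [AlgEquiv.trans_apply, D.ρI, D.σI]
  αg₁ := by simp only [AlgEquiv.trans_apply, map_mul, map_neg, D.ρs2, D.ρI, D.σs2, D.σI]; ring
  αg₂ := by rw [AlgEquiv.trans_apply, D.ρs3, D.σs3]
  τg₁ := by rw [map_mul, D.τs2, D.τI]
  τg₂ := D.τs3

/-- FRAME `(−2, −3)`: `g₁ = s2·I`, `g₂ = s3·I`, `α = σρτ` (the field `ℚ₂(√−2, √−3) = ℚ₂(√14, √5) ∋ √6`; RAMIFIED). -/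
def FullLocalData.framem2m3 : D.toLocalData23.Frame where
  g₁ := D.s2 * D.I
  g₂ := D.s3 * D.I
  c₂ := -3
  α := (D.τ.trans D.ρ).trans D.σ
  g₁_inV8 := D.inV8_s2I
  g₂_sq := by rw [mul_pow, D.hs3, D.hI, map_neg, map_ofNat]; ring
  αI := by rw [AlgEquiv.trans_apply, AlgEquiv.trans_apply, D.τI, D.ρI, D.σI]
  αg₁ := by
    simp only [AlgEquiv.trans_apply, map_mul, map_neg, D.τs2, D.τI, D.ρs2, D.ρI, D.σs2, D.σI]; ring
  αg₂ := by
    simp only [AlgEquiv.trans_apply, map_mul, map_neg, D.τs3, D.τI, D.ρs3, D.ρI, D.σs3, D.σI]; ring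
  τg₁ := by rw [map_mul, D.τs2, D.τI]
  τg₂ := by rw [map_mul, D.τs3, D.τI]; ring

/-- Squares of the first generators: `s2² = 2`, `(s2·I)² = −2`. -/
theorem FullLocalData.g₁_sq :
    D.frame23.g₁ ^ 2 = algebraMap ℚ_[2] Ω 2 ∧ D.frame2m3.g₁ ^ 2 = algebraMap ℚ_[2] Ω 2 ∧
      D.framem23.g₁ ^ 2 = algebraMap ℚ_[2] Ω (-2) ∧ D.framem2m3.g₁ ^ 2 = algebraMap ℚ_[2] Ω (-2) := by
  refine ⟨?_, ?_, ?_, ?_⟩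
  · change D.s2 ^ 2 = _; rw [D.hs2, map_ofNat]
  · change D.s2 ^ 2 = _; rw [D.hs2, map_ofNat]
  · change (D.s2 * D.I) ^ 2 = _; rw [mul_pow, D.hs2, D.hI, map_neg, map_ofNat]; ring
  · change (D.s2 * D.I) ^ 2 = _; rw [mul_pow, D.hs2, D.hI, map_neg, map_ofNat]; ring

end Frames

/-! ## The full local data exist in `Ω₂` -/

/-- `‖2/3‖₂ = 1/2`. -/
theorem TwoAdic.norm_two_thirds : ‖(2 / 3 : ℚ_[2])‖ = 2⁻¹ := by
  obtain ⟨n2, -, -, -, nm23⟩ := TwoAdic.norm_eq_half_cases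
  rw [← norm_neg, ← neg_div]
  exact nm23

/-- THE FULL LOCAL DATA EXIST in `Ω₂`: as `nonempty_localData23`, with `ρ` now constructed over `ℚ₂(i, s3)`
(`2 ∉ ℚ₂(i, s3)²` from `3 ∉ ℚ₂(i)²` and `2, 2/3 ∉ ℚ₂(i)²`). -/
theorem nonempty_fullLocalData : Nonempty (FullLocalData Ω₂) := by
  obtain ⟨I, hI⟩ := IsAlgClosed.exists_pow_nat_eq (-1 : Ω₂) two_pos
  obtain ⟨s2, hs2⟩ := IsAlgClosed.exists_pow_nat_eq (2 : Ω₂) two_pos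
  obtain ⟨s3, hs3⟩ := IsAlgClosed.exists_pow_nat_eq (3 : Ω₂) two_pos
  have hI' : I ^ 2 = algebraMap ℚ_[2] Ω₂ (-1) := by rw [hI, map_neg, map_one]
  have hs2' : s2 ^ 2 = algebraMap ℚ_[2] Ω₂ 2 := by rw [hs2, map_ofNat]
  have hs3' : s3 ^ 2 = algebraMap ℚ_[2] Ω₂ 3 := by rw [hs3, map_ofNat]
  obtain ⟨f1, f3, fm3, fm13⟩ := sq_ne_of_mem_adjoin_sqrt2 hs2
  -- σ : negate I over ℚ₂(s2, s3)
  have hσE : ∀ e ∈ ℚ_[2]⟮s2, s3⟯, e ^ 2 ≠ algebraMap ℚ_[2] Ω₂ (-1) :=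
    sq_ne_of_mem_adjoin_two hs3' (by norm_num) f3 f1
      (fun e he => by rw [show (-1 : ℚ_[2]) / 3 = -1 / 3 by norm_num]; exact fm13 e he)
  obtain ⟨σ, hσI, hσE'⟩ := exists_aut_neg ℚ_[2]⟮s2, s3⟯ hI' hσE
  -- τ : negate s3 over ℚ₂(s2, I)
  have hτE : ∀ e ∈ ℚ_[2]⟮s2, I⟯, e ^ 2 ≠ algebraMap ℚ_[2] Ω₂ 3 :=
    sq_ne_of_mem_adjoin_two hI' (by norm_num) f1 f3
      (fun e he => by rw [show (3 : ℚ_[2]) / -1 = -3 by norm_num]; exact fm3 e he)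
  obtain ⟨τ, hτs3, hτE'⟩ := exists_aut_neg ℚ_[2]⟮s2, I⟯ hs3' hτE
  -- ρ : negate s2 over ℚ₂(I, s3)
  obtain ⟨n2, nm2, -, -, nm23⟩ := TwoAdic.norm_eq_half_cases
  have g2 : ∀ e ∈ ℚ_[2]⟮I⟯, e ^ 2 ≠ algebraMap ℚ_[2] Ω₂ 2 :=
    sq_ne_of_mem_adjoin_root hI' TwoAdic.sq_ne_neg_one (TwoAdic.sq_ne_of_norm_eq_half n2)
      (fun q => by rw [show (2 : ℚ_[2]) * -1 = -2 by norm_num]; exact TwoAdic.sq_ne_of_norm_eq_half nm2 q)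
  have g23 : ∀ e ∈ ℚ_[2]⟮I⟯, e ^ 2 ≠ algebraMap ℚ_[2] Ω₂ (2 / 3) :=
    sq_ne_of_mem_adjoin_root hI' TwoAdic.sq_ne_neg_one (TwoAdic.sq_ne_of_norm_eq_half TwoAdic.norm_two_thirds)
      (fun q => by rw [show (2 / 3 : ℚ_[2]) * -1 = -2 / 3 by norm_num]; exact TwoAdic.sq_ne_of_norm_eq_half nm23 q)
  have hρE : ∀ e ∈ ℚ_[2]⟮I, s3⟯, e ^ 2 ≠ algebraMap ℚ_[2] Ω₂ 2 :=
    sq_ne_of_mem_adjoin_two hs3' (by norm_num) (sq_ne_three_of_mem_adjoin_I hI) g2 g23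
  obtain ⟨ρ, hρs2, hρE'⟩ := exists_aut_neg ℚ_[2]⟮I, s3⟯ hs2' hρE
  have m2 : s2 ∈ ℚ_[2]⟮s2, s3⟯ := subset_adjoin _ _ (by simp)
  have m3 : s3 ∈ ℚ_[2]⟮s2, s3⟯ := subset_adjoin _ _ (by simp)
  have m2' : s2 ∈ ℚ_[2]⟮s2, I⟯ := subset_adjoin _ _ (by simp)
  have mI' : I ∈ ℚ_[2]⟮s2, I⟯ := subset_adjoin _ _ (by simp)
  have mI'' : I ∈ ℚ_[2]⟮I, s3⟯ := subset_adjoin _ _ (by simp)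
  have m3'' : s3 ∈ ℚ_[2]⟮I, s3⟯ := subset_adjoin _ _ (by simp)
  exact ⟨⟨⟨I, s2, s3, hI, hs2, hs3, σ, τ, ρ, hσI, hσE' s2 m2, hσE' s3 m3, hτE' I mI', hτE' s2 m2', hτs3,
    hρE' I mI'', hρs2⟩, hρE' s3 m3''⟩⟩

/-- A fixed choice of full local data in `Ω₂`. -/
def fullLocalData₂ : FullLocalData Ω₂ := Classical.choice nonempty_fullLocalData

/-! ## Square roots inside the frames -/

/-- HENSEL for integers: `m ≡ 1 (mod 8)` is a square in `ℚ₂`. -/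
theorem TwoAdic.exists_sq_eq_of_int_mod_eight_eq_one (m : ℤ) (hm : m % 8 = 1) : ∃ r : ℚ_[2], r ^ 2 = m := by
  set F : Polynomial ℤ := X ^ 2 - C m with hF
  have hFa : F.aeval (1 : ℤ_[2]) = ((1 - m : ℤ) : ℤ_[2]) := by
    simp only [hF, map_sub, map_pow, aeval_X, aeval_C, algebraMap_int_eq, Int.coe_castRingHom, one_pow, Int.cast_sub,
      Int.cast_one]
  have hF' : (Polynomial.derivative F).aeval (1 : ℤ_[2]) = 2 := by
    have hd : Polynomial.derivative F = C (2 : ℤ) * X := by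
      rw [hF, derivative_sub, derivative_X_pow, derivative_C, sub_zero]
      simp
    rw [hd, map_mul, aeval_C, aeval_X, mul_one, algebraMap_int_eq, Int.coe_castRingHom]
    norm_num
  have hdvd : ((2 : ℕ) ^ 3 : ℤ) ∣ (1 - m : ℤ) := by omega
  have hnorm : ‖F.aeval (1 : ℤ_[2])‖ < ‖(Polynomial.derivative F).aeval (1 : ℤ_[2])‖ ^ 2 := by
    rw [hFa, hF']
    have h1 : ‖((1 - m : ℤ) : ℤ_[2])‖ ≤ (2 : ℝ) ^ (-(3 : ℕ) : ℤ) := by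
      have := (PadicInt.norm_int_le_pow_iff_dvd (p := 2) (k := 1 - m) (n := 3)).2 hdvd
      simpa using this
    have h2 : ‖(2 : ℤ_[2])‖ = 2⁻¹ := by simpa using PadicInt.norm_p (p := 2)
    rw [h2]
    calc ‖((1 - m : ℤ) : ℤ_[2])‖ ≤ (2 : ℝ) ^ (-(3 : ℕ) : ℤ) := h1
      _ < (2⁻¹ : ℝ) ^ 2 := by norm_num
  obtain ⟨z, hz, -⟩ := hensels_lemma hnorm
  refine ⟨(z : ℚ_[2]), ?_⟩
  have hz' : z ^ 2 = (m : ℤ_[2]) := by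
    have : F.aeval z = z ^ 2 - (m : ℤ_[2]) := by
      simp only [hF, map_sub, map_pow, aeval_X, aeval_C, algebraMap_int_eq, Int.coe_castRingHom]
    rw [this] at hz
    exact sub_eq_zero.1 hz
  have := congrArg (fun t : ℤ_[2] => (t : ℚ_[2])) hz'
  simpa using this

/-- SQUARE ROOTS IN A FRAME.  Let `g₁² = c₁`, `g₂² = c₂` (`c₂ ≠ 0`).  If for some integer `m ≡ 1 (mod 8)` one of
`d = m`, `d·c₂ = m`, `d = m·c₁`, `d·c₂ = m·c₁` holds in `ℚ₂`, then `√d ∈ ℚ₂(g₁, g₂)` (as `r, r/g₂, r·g₁, r·g₁/g₂` with `r² = m`). -/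
theorem exists_sq_eq_in_frame {g₁ g₂ : Ω₂} {c₁ c₂ : ℚ_[2]} (hg₁ : g₁ ^ 2 = algebraMap ℚ_[2] Ω₂ c₁)
    (hg₂ : g₂ ^ 2 = algebraMap ℚ_[2] Ω₂ c₂) (hc₂ : c₂ ≠ 0) (d : ℕ)
    (h : ∃ m : ℤ, m % 8 = 1 ∧ ((d : ℚ_[2]) = m ∨ (d : ℚ_[2]) * c₂ = m ∨ (d : ℚ_[2]) = m * c₁ ∨ (d : ℚ_[2]) * c₂ = m * c₁)) :
    ∃ w ∈ ℚ_[2]⟮g₁, g₂⟯, w ^ 2 = (d : Ω₂) := by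
  obtain ⟨m, hm8, hcase⟩ := h
  obtain ⟨r, hr⟩ := TwoAdic.exists_sq_eq_of_int_mod_eight_eq_one m hm8
  have m1 : g₁ ∈ ℚ_[2]⟮g₁, g₂⟯ := subset_adjoin _ _ (by simp)
  have m2 : g₂ ∈ ℚ_[2]⟮g₁, g₂⟯ := subset_adjoin _ _ (by simp)
  have hg₂ne : g₂ ≠ 0 := by
    intro h0; rw [h0, zero_pow two_ne_zero, eq_comm, map_eq_zero] at hg₂; exact hc₂ hg₂
  have hdΩ : (d : Ω₂) = algebraMap ℚ_[2] Ω₂ (d : ℚ_[2]) := by rw [map_natCast]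
  have hrm : algebraMap ℚ_[2] Ω₂ (m : ℚ_[2]) = (algebraMap ℚ_[2] Ω₂ r) ^ 2 := by rw [← map_pow, hr]
  rcases hcase with h1 | h2 | h3 | h4
  · refine ⟨algebraMap ℚ_[2] Ω₂ r, IntermediateField.algebraMap_mem _ _, ?_⟩
    rw [hdΩ, h1, hrm]
  · refine ⟨algebraMap ℚ_[2] Ω₂ r / g₂, div_mem (IntermediateField.algebraMap_mem _ _) m2, ?_⟩
    rw [div_pow, ← hrm, ← h2, map_mul, hg₂, mul_div_assoc, div_self ((_root_.map_ne_zero _).2 hc₂), mul_one, hdΩ]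
  · refine ⟨algebraMap ℚ_[2] Ω₂ r * g₁, mul_mem (IntermediateField.algebraMap_mem _ _) m1, ?_⟩
    rw [mul_pow, ← hrm, hg₁, ← map_mul, ← h3, hdΩ]
  · refine ⟨algebraMap ℚ_[2] Ω₂ r * g₁ / g₂, div_mem (mul_mem (IntermediateField.algebraMap_mem _ _) m1) m2, ?_⟩
    rw [div_pow, mul_pow, ← hrm, hg₁, hg₂, ← map_mul, ← h4, map_mul, mul_div_assoc,
      div_self ((_root_.map_ne_zero _).2 hc₂), mul_one, hdΩ]

/-- Four-coefficient form of the elements of `ℚ₂(g₁, g₂)` (`g₁² = c₁`, `g₂² = c₂` in `ℚ₂`). -/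
theorem exists_coeffs_of_mem_adjoin_pair {g₁ g₂ : Ω₂} {c₁ c₂ : ℚ_[2]} (hg₁ : g₁ ^ 2 = algebraMap ℚ_[2] Ω₂ c₁)
    (hg₂ : g₂ ^ 2 = algebraMap ℚ_[2] Ω₂ c₂) {e : Ω₂} (he : e ∈ ℚ_[2]⟮g₁, g₂⟯) :
    ∃ a b c d : ℚ_[2], e = (algebraMap ℚ_[2] Ω₂ a + algebraMap ℚ_[2] Ω₂ b * g₁) +
      (algebraMap ℚ_[2] Ω₂ c + algebraMap ℚ_[2] Ω₂ d * g₁) * g₂ := by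
  set F := ℚ_[2]⟮g₁⟯ with hF
  have he' : e ∈ F⟮g₂⟯ := by
    have : e ∈ (F⟮g₂⟯).restrictScalars ℚ_[2] := by rw [adjoin_simple_adjoin_simple]; exact he
    exact this
  have htF : g₂ ^ 2 = algebraMap F Ω₂ ⟨algebraMap ℚ_[2] Ω₂ c₂, IntermediateField.algebraMap_mem _ c₂⟩ := by
    rw [hg₂]; rfl
  obtain ⟨A, B, hAB⟩ := exists_coeffs_of_mem_adjoin_simple htF he'
  obtain ⟨a, b, hA⟩ := exists_coeffs_of_mem_adjoin_simple hg₁ A.2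
  obtain ⟨c, d, hB⟩ := exists_coeffs_of_mem_adjoin_simple hg₁ B.2
  refine ⟨a, b, c, d, ?_⟩
  rw [hAB]
  change (A : Ω₂) + (B : Ω₂) * g₂ = _
  rw [hA, hB]

/-! ## The reduction theorems for a frame -/

/-- FOUR COLOURS.  Let `K ⊆ ℝ` be a subfield with a ring homomorphism `φ : K → Ω₂` whose image lies in `ℚ₂(g₁, g₂)` for
a step frame `F` (`g₁² ∈ ℚ₂`).  Then every graph with `K`-coordinates and unit-quadrance edges is `4`-colourable. -/
theorem colorable_four_of_embedding_frame (K : IntermediateField ℚ ℝ) {D : LocalData23 Ω₂} (F : D.Frame) {c₁ : ℚ_[2]}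
    (hg₁ : F.g₁ ^ 2 = algebraMap ℚ_[2] Ω₂ c₁) (φ : K →+* Ω₂) (hφ : ∀ t, φ t ∈ ℚ_[2]⟮F.g₁, F.g₂⟯)
    {V : Type*} {G : SimpleGraph V} (x y : V → K)
    (hadj : ∀ ⦃v w : V⦄, G.Adj v w → (x v - x w) ^ 2 + (y v - y w) ^ 2 = 1) : G.Colorable 4 := by
  let z : V → Ω₂ := fun v => φ (x v) + D.I * φ (y v)
  apply F.colorable_four z
  intro v w hvw
  obtain ⟨a, b, c, d, hX⟩ := exists_coeffs_of_mem_adjoin_pair hg₁ F.g₂_sq (hφ (x v - x w))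
  obtain ⟨e, f, g, h, hY⟩ := exists_coeffs_of_mem_adjoin_pair hg₁ F.g₂_sq (hφ (y v - y w))
  refine ⟨a, b, c, d, e, f, g, h, ?_, ?_⟩
  · change (φ (x v) + D.I * φ (y v)) - (φ (x w) + D.I * φ (y w)) = _
    rw [← hX, ← hY, map_sub, map_sub]; ring
  · rw [← hX, ← hY, ← map_pow, ← map_pow, ← map_add, hadj hvw, map_one]

/-- TWO COLOURS (the ramified frames).  With the data of `colorable_four_of_embedding_frame` and `c₂ = −3`, every graph
with `K`-coordinates and unit-quadrance edges is BIPARTITE. -/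
theorem colorable_two_of_embedding_frame (K : IntermediateField ℚ ℝ) {D : LocalData23 Ω₂} (F : D.Frame)
    (h3 : F.c₂ = -3) {c₁ : ℚ_[2]} (hg₁ : F.g₁ ^ 2 = algebraMap ℚ_[2] Ω₂ c₁) (φ : K →+* Ω₂)
    (hφ : ∀ t, φ t ∈ ℚ_[2]⟮F.g₁, F.g₂⟯) {V : Type*} {G : SimpleGraph V} (x y : V → K)
    (hadj : ∀ ⦃v w : V⦄, G.Adj v w → (x v - x w) ^ 2 + (y v - y w) ^ 2 = 1) : G.Colorable 2 := by
  let z : V → Ω₂ := fun v => φ (x v) + D.I * φ (y v)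
  apply F.colorable_two h3 z
  intro v w hvw
  obtain ⟨a, b, c, d, hX⟩ := exists_coeffs_of_mem_adjoin_pair hg₁ F.g₂_sq (hφ (x v - x w))
  obtain ⟨e, f, g, h, hY⟩ := exists_coeffs_of_mem_adjoin_pair hg₁ F.g₂_sq (hφ (y v - y w))
  refine ⟨a, b, c, d, e, f, g, h, ?_, ?_⟩
  · change (φ (x v) + D.I * φ (y v)) - (φ (x w) + D.I * φ (y w)) = _
    rw [← hX, ← hY, map_sub, map_sub]; ring
  · rw [← hX, ← hY, ← map_pow, ← map_pow, ← map_add, hadj hvw, map_one]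

end Summit.Ventures.DiscreteObjects.UnitDistance.MoserLocal
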